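import Summits.AtomisticToContinuum.Crystallization.Theorems.OverbindingBudgetAffineCompressedCutEstablishTwo

/-!
# NODE g81 «Seed», file 1 of 2 — R2 geometry: the layer lattice and the LAYER-DISC INDUCTION (rider R2, geometry half)

Route `OverbindingBudget` (Crystallization), crux `RobustDefectLimitWindows` (stmt-AtomisticToContinuum-31280), decomp-a2c lens 4, generation 81; open leaf
NS♭₂ ⟸ 79K ⟸ LR(r₁) ⟸ R1 «ExactStep» → R2 «Seed» (engine `…CompressedCutEstablish`, `…CompressedCutEstablishTwo`; THIS FILE + `…SeedTwo` = geometry)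
→ R3 «Stack» → R4.

WHAT THIS FILE PROVES (potential-free, sorry-free; every constant symbolic except the record constants `10⁻⁴, 10⁻³, 1/450` already in the tree).
* §1 THE LAYER LATTICE in model coordinates: `InLayer x` (coordinate sum `0`, coordinates `≡ 0 (mod 3)` — the triangular lattice generated by the basal
  hexagon `hexL`), `lnorm` (the `ℓ¹` size `= 6 ×` hex distance), `hexL_facts` (`hexL ⊆` layer, `tsq = 18`), `inLayer_tsub`, and the DESCENT LEMMA
  `hex_descent`: every non-zero layer vector `x` has a hexagon vector `h` with `lnorm (x − h) + 6 = lnorm x` — so the layer disc of hex radius `d + 1` is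
  reached from the disc of radius `d` by single basal bonds (ONE-PARENT steps suffice inside a layer).
* §2 `estab_mono` (weakening `τ, D`), label identities.
* §3 ★★ `layer_disc`: THE LAYER-DISC INDUCTION.  From ONE established seed `j₀` (chart onto a copy `C ⊇ hexL`, label `λ₀`, bounds `τs 0, Ds 0`), one-parent
  kernel tables along `xs ⊇ hexL` whose outputs are forced to be `C` on the ball (`hQC` — E1 rows for `H`/`H′` layers: fcc child impossible, hcp child
  `↦ C`; KF rows for the `F⁺` seed layer of an all-fcc ball), monotone bound sequences `τs, Ds : ℕ → ℝ` satisfying the two STEP INEQUALITIES below `n`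
  (link `+ (5/2)(2·10⁻⁴·Λ^d + 10⁻⁴·Λ^(d+1))·nn_{j₀}`, position `+ 10⁻⁴·Λ^d·nn_{j₀} + τs d`, `Λ = 1.0011`; an admissible linear/quadratic pair is certified in
  `…SeedTwo.admissible_bounds`) and ROOM in the ball (`‖B (mv (λ₀ + x))‖ + Ds n ≤ r` on the disc), EVERY layer point `λ₀ + x` with `lnorm x ≤ 6d`,
  `d ≤ n`, is the label of an established site `k` of the ball, charted onto `C`, with `τ ≤ τs d`, `D ≤ Ds d` and the scale window
  `0.9967^d·nn_{j₀} ≤ nn_k ≤ 1.0011^d·nn_{j₀}`.  Record instances: `layer_disc_hcp_base` (base site hcp: `C = H`, tables E1, NO assumption on the other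
  sites' types), `layer_disc_fcc_ball` (all sites of the ball fcc: `C = F⁺`, tables KF); `hexL_sub`, `fcc_ne_hcp`.
File 2 (`…SeedTwo`): uniqueness of established sites / charts (order-independence), seeds, the O8 normalisation of a found hcp site, re-basing, admissible
bound sequences.
HOW R3/R4 USE IT: Step A = `…SeedTwo.seed_hcp` at the re-based nearest hcp site (or `seed_fcc` + `layer_disc_fcc_ball`), Step S = `layer_disc_hcp_base`; R3
climbs layers with `…EstablishTwo.estab_child_two` from pairs of adjacent disc sites; R4 instantiates `τs, Ds, n, r` numerically (disc radii ρ₁(u), reach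
budget, slab covering radius) and proves the room inequality.

Deps: `…CompressedCutEstablishTwo`.  No `instance`, no `notation`, no `set_option`, no new axioms, 0 sorry.
-/


namespace Summit.AtomisticToContinuum.Crystallization.Theorems.OverbindingBudgetAffineCompressedCutSeed

open Literature.Geometry.DiscreteGeometry (nearestDist nearestDist_nonneg nearestDist_le_dist fccTwoShellPattern hcpTwoShellPattern
  norm_le_sqrt_two_of_mem_twoShellPattern)
open Summit.AtomisticToContinuum.Crystallization.Theorems.OverbindingBudgetAffineCompressedCutKernel (T3 tsub tadd tsq tflip fccL hcpL fccNegL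
  hcpAltL hexL hcpFamilyL kernelOneB fccShellL kf_fcc kf_hcp e1_entries)
open Summit.AtomisticToContinuum.Crystallization.Theorems.OverbindingBudgetAffineCompressedCutCharts (mv mv_tadd mv_zero mv_injective Carries ListedBy
  listedBy_fcc listedBy_hcp norm_mv_eq_one_iff)
open Summit.AtomisticToContinuum.Crystallization.Theorems.OverbindingBudgetAffineCompressedCutEstablish (site_eq_of_close Estab estab_seed
  estab_child_one charts_close link_nonneg chart_eq_of_carries copies_separated)
open Summit.AtomisticToContinuum.Crystallization.Theorems.OverbindingBudgetAffineCompressedCutEstablishTwo (IsSign flipIso estab_flip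
  carries_hcpFamily_normalise)

variable {N : ℕ}

/-! ## §1  The layer lattice and the descent lemma -/

/-- In-layer model vectors: the triangular lattice `{3(a,b,c) : a + b + c = 0}` generated by the basal hexagon `hexL` (coordinate sum `0`, coordinates
divisible by `3`; the third divisibility follows). [this file] -/
def InLayer (x : T3) : Prop := x.1 + x.2.1 + x.2.2 = 0 ∧ (3 : ℤ) ∣ x.1 ∧ (3 : ℤ) ∣ x.2.1

/-- The `ℓ¹` size of a model vector (on the layer lattice: `6 ×` the hex distance to the origin). [this file] -/
def lnorm (x : T3) : ℤ := |x.1| + |x.2.1| + |x.2.2|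

/-- `lnorm ≥ 0`. [this file] -/
theorem lnorm_nonneg (x : T3) : 0 ≤ lnorm x := by
  unfold lnorm; positivity

/-- Only the origin has `lnorm ≤ 0`. [this file] -/
theorem eq_zero_of_lnorm_le (x : T3) (h : lnorm x ≤ 0) : x = (0, 0, 0) := by
  obtain ⟨a, b, c⟩ := x
  simp only [lnorm] at h
  have ha : |a| = 0 := by linarith [abs_nonneg a, abs_nonneg b, abs_nonneg c]
  have hb : |b| = 0 := by linarith [abs_nonneg a, abs_nonneg b, abs_nonneg c]
  have hc : |c| = 0 := by linarith [abs_nonneg a, abs_nonneg b, abs_nonneg c]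
  rw [abs_eq_zero] at ha hb hc
  subst ha; subst hb; subst hc; rfl

/-- The origin is a layer vector. [this file] -/
theorem inLayer_zero : InLayer (0, 0, 0) := ⟨by norm_num, dvd_zero 3, dvd_zero 3⟩

/-- The basal hexagon consists of layer vectors of `tsq = 18` (model length `1`). [this file] -/
theorem hexL_facts : ∀ h ∈ hexL, InLayer h ∧ tsq h = 18 := by
  intro h hh
  simp only [hexL, List.mem_cons, List.not_mem_nil, or_false] at hh
  rcases hh with rfl | rfl | rfl | rfl | rfl | rfl <;> exact ⟨⟨by norm_num, by norm_num, by norm_num⟩, by decide⟩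

/-- The layer lattice is closed under differences. [this file] -/
theorem inLayer_tsub {x h : T3} (hx : InLayer x) (hh : InLayer h) : InLayer (tsub x h) := by
  obtain ⟨a, b, c⟩ := x
  obtain ⟨d, e, g⟩ := h
  obtain ⟨hs, ha, hb⟩ := hx
  obtain ⟨hs', hd, he⟩ := hh
  dsimp only at hs ha hb hs' hd he
  refine ⟨?_, ?_, ?_⟩ <;> dsimp only [tsub]
  · linarith
  · exact dvd_sub ha hd
  · exact dvd_sub hb he

/-- `|t − 3| + 3 = |t|` for `t ≥ 3`. [this file] -/
private theorem abs_sub_three {t : ℤ} (ht : 3 ≤ t) : |t - 3| + 3 = |t| := by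
  rw [abs_of_nonneg (by omega), abs_of_nonneg (by omega)]; ring

/-- `|t + 3| + 3 = |t|` for `t ≤ −3`. [this file] -/
private theorem abs_add_three {t : ℤ} (ht : t ≤ -3) : |t + 3| + 3 = |t| := by
  rw [abs_of_nonpos (by omega), abs_of_nonpos (by omega)]; ring

/-- ★ **DESCENT LEMMA.**  Every non-zero layer vector is one basal bond away from a layer vector of hex distance one less: there is `h ∈ hexL` with
`lnorm (x − h) + 6 = lnorm x`.  (Take `+3` off a positive coordinate and `−3` off a negative one.) [this file] -/
theorem hex_descent {x : T3} (hx : InLayer x) (hne : x ≠ (0, 0, 0)) : ∃ h ∈ hexL, lnorm (tsub x h) + 6 = lnorm x := by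
  obtain ⟨a, b, c⟩ := x
  obtain ⟨hs, ha3, hb3⟩ := hx
  dsimp only at hs ha3 hb3
  simp only [lnorm, tsub]
  rcases lt_trichotomy 0 a with ha | ha | ha
  · have ha' : 3 ≤ a := by omega
    rcases lt_or_ge b 0 with hb | hb
    · have hb' : b ≤ -3 := by omega
      refine ⟨(3, -3, 0), by decide, ?_⟩
      have e1 := abs_sub_three ha'
      have e2 := abs_add_three hb'
      simp only [sub_neg_eq_add, sub_zero]
      linarith
    · have hc' : c ≤ -3 := by omega
      refine ⟨(3, 0, -3), by decide, ?_⟩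
      have e1 := abs_sub_three ha'
      have e2 := abs_add_three hc'
      simp only [sub_neg_eq_add, sub_zero]
      linarith
  · subst ha
    rcases lt_trichotomy 0 b with hb | hb | hb
    · have hb' : 3 ≤ b := by omega
      have hc' : c ≤ -3 := by omega
      refine ⟨(0, 3, -3), by decide, ?_⟩
      have e1 := abs_sub_three hb'
      have e2 := abs_add_three hc'
      simp only [sub_neg_eq_add, sub_zero]
      linarith
    · subst hb
      have hc : c = 0 := by omega
      subst hc
      exact absurd rfl hne
    · have hb' : b ≤ -3 := by omega
      have hc' : 3 ≤ c := by omega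
      refine ⟨(0, -3, 3), by decide, ?_⟩
      have e1 := abs_add_three hb'
      have e2 := abs_sub_three hc'
      simp only [sub_neg_eq_add, sub_zero]
      linarith
  · have ha' : a ≤ -3 := by omega
    rcases lt_or_ge 0 b with hb | hb
    · have hb' : 3 ≤ b := by omega
      refine ⟨(-3, 3, 0), by decide, ?_⟩
      have e1 := abs_add_three ha'
      have e2 := abs_sub_three hb'
      simp only [sub_neg_eq_add, sub_zero]
      linarith
    · have hc' : 3 ≤ c := by omega
      refine ⟨(-3, 0, 3), by decide, ?_⟩
      have e1 := abs_add_three ha'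
      have e2 := abs_sub_three hc'
      simp only [sub_neg_eq_add, sub_zero]
      linarith

/-! ## §2  Weakening and label identities -/

/-- `Estab` is monotone in the link and position bounds. [this file] -/
theorem estab_mono {y : Fin N → EuclideanSpace ℝ (Fin 3)} {A : Fin N → (EuclideanSpace ℝ (Fin 3) →ₗ[ℝ] EuclideanSpace ℝ (Fin 3))}
    {P : Fin N → Finset (EuclideanSpace ℝ (Fin 3))} {B : EuclideanSpace ℝ (Fin 3) →ₗ[ℝ] EuclideanSpace ℝ (Fin 3)} {i j : Fin N}
    {M : EuclideanSpace ℝ (Fin 3) →ₗᵢ[ℝ] EuclideanSpace ℝ (Fin 3)} {C : List T3} {lam : T3} {τ τ' D D' : ℝ}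
    (hE : Estab y A P B i j M C lam τ D) (hτ : τ ≤ τ') (hD : D ≤ D') : Estab y A P B i j M C lam τ' D' :=
  ⟨hE.1, fun x => (hE.2.1 x).trans (mul_le_mul_of_nonneg_right hτ (norm_nonneg _)), hE.2.2.trans hD⟩

/-- `(λ + (x − h)) + h = λ + x`. [this file] -/
theorem tadd_tadd_tsub (l x h : T3) : tadd (tadd l (tsub x h)) h = tadd l x := by
  obtain ⟨l₁, l₂, l₃⟩ := l
  obtain ⟨x₁, x₂, x₃⟩ := x
  obtain ⟨h₁, h₂, h₃⟩ := h
  simp only [tadd, tsub]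
  refine Prod.ext ?_ (Prod.ext ?_ ?_) <;> dsimp only <;> ring

/-- `λ + 0 = λ`. [this file] -/
theorem tadd_zero_right (l : T3) : tadd l (0, 0, 0) = l := by
  obtain ⟨l₁, l₂, l₃⟩ := l
  simp only [tadd]
  refine Prod.ext ?_ (Prod.ext ?_ ?_) <;> simp

/-- `0 + x = x`. [this file] -/
theorem tadd_zero_left (x : T3) : tadd (0, 0, 0) x = x := by
  obtain ⟨x₁, x₂, x₃⟩ := x
  simp only [tadd]
  refine Prod.ext ?_ (Prod.ext ?_ ?_) <;> simp

/-! ## §3  The layer-disc induction -/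

/-- ★★ **LAYER-DISC INDUCTION.**  See the module docstring.  Hypotheses: the ball data at base `i`, radius `r`; a copy `C ⊇ hexL`, offsets `xs ⊇ hexL`,
one-parent kernel tables (members of length `≤ 18`) whose outputs are FORCED to be `C` on the ball (`hQC`); an established seed `j₀` (label `λ₀`,
bounds `τs 0, Ds 0`); monotone bound sequences obeying the two step inequalities below `n`; room in the ball on the disc of hex radius `n`.  Conclusion:
every layer point of hex radius `d ≤ n` around `λ₀` is the label of an established site of the ball, charted onto `C`, within `τs d, Ds d` and the scale
window `[0.9967^d, 1.0011^d]·nn_{j₀}`.  Proof: induction on `d` through `hex_descent` and `…Establish.estab_child_one`. [this file] -/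
theorem layer_disc {y : Fin N → EuclideanSpace ℝ (Fin 3)} (hy : Function.Injective y) {r : ℝ} {i : Fin N}
    {A : Fin N → (EuclideanSpace ℝ (Fin 3) →ₗ[ℝ] EuclideanSpace ℝ (Fin 3))} {Qf : Fin N → (EuclideanSpace ℝ (Fin 3) →ₗᵢ[ℝ] EuclideanSpace ℝ (Fin 3))}
    {P : Fin N → Finset (EuclideanSpace ℝ (Fin 3))} {f : Fin N → EuclideanSpace ℝ (Fin 3) → EuclideanSpace ℝ (Fin 3)}
    {B : EuclideanSpace ℝ (Fin 3) →ₗ[ℝ] EuclideanSpace ℝ (Fin 3)}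
    (hP : ∀ j, dist (y j) (y i) ≤ r → (P j = fccTwoShellPattern ∨ P j = hcpTwoShellPattern))
    (hA : ∀ j, dist (y j) (y i) ≤ r → ∀ v ∈ P j, ‖A j v - Qf j v‖ ≤ 1 / 1000)
    (hf : ∀ j, dist (y j) (y i) ≤ r → ∀ v ∈ P j, f j v ∈ Set.range y ∧ dist (f j v) (y j + nearestDist y j • A j v) ≤ 1 / 10 ^ 4 * nearestDist y j)
    (hinj : ∀ j, dist (y j) (y i) ≤ r → Set.InjOn (f j) ↑(P j))
    (hex : ∀ j, dist (y j) (y i) ≤ r → ∀ m, m ≠ j → dist (y m) (y j) ≤ (3 / 2 + 1 / 450) * nearestDist y j → ∃ v ∈ P j, f j v = y m)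
    {C xs : List T3} {Qsf Qsh : List (List T3)} (hKf : kernelOneB C xs fccL Qsf = true) (hKh : kernelOneB C xs hcpL Qsh = true)
    (hlf : ∀ Q ∈ Qsf, Q.length ≤ 18) (hlh : ∀ Q ∈ Qsh, Q.length ≤ 18) (hhexC : ∀ h ∈ hexL, h ∈ C) (hhexxs : ∀ h ∈ hexL, h ∈ xs)
    (hQC : ∀ k, dist (y k) (y i) ≤ r → ∀ Q : List T3,
      ((P k = fccTwoShellPattern ∧ Q ∈ Qsf) ∨ (P k = hcpTwoShellPattern ∧ Q ∈ Qsh)) → Q = C)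
    {j₀ : Fin N} {M₀ : EuclideanSpace ℝ (Fin 3) →ₗᵢ[ℝ] EuclideanSpace ℝ (Fin 3)} {lam₀ : T3} {τs Ds : ℕ → ℝ} {n : ℕ}
    (hj₀ : dist (y j₀) (y i) ≤ r) (hE₀ : Estab y A P B i j₀ M₀ C lam₀ (τs 0) (Ds 0)) (hτmono : Monotone τs) (hDmono : Monotone Ds)
    (hτs : ∀ d : ℕ, d + 1 ≤ n → τs d + 5 / 2 * (2 * (1 / 10 ^ 4) * ((10011 / 10000 : ℝ) ^ d * nearestDist y j₀) +
      1 / 10 ^ 4 * ((10011 / 10000 : ℝ) ^ (d + 1) * nearestDist y j₀)) ≤ τs (d + 1))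
    (hDs : ∀ d : ℕ, d + 1 ≤ n → Ds d + 1 / 10 ^ 4 * ((10011 / 10000 : ℝ) ^ d * nearestDist y j₀) + τs d ≤ Ds (d + 1))
    (hroom : ∀ x, InLayer x → lnorm x ≤ 6 * (n : ℤ) → ‖B (mv (tadd lam₀ x))‖ + Ds n ≤ r) :
    ∀ d : ℕ, d ≤ n → ∀ x : T3, InLayer x → lnorm x ≤ 6 * (d : ℤ) →
      ∃ k : Fin N, ∃ M : EuclideanSpace ℝ (Fin 3) →ₗᵢ[ℝ] EuclideanSpace ℝ (Fin 3), dist (y k) (y i) ≤ r ∧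
        (9967 / 10000 : ℝ) ^ d * nearestDist y j₀ ≤ nearestDist y k ∧ nearestDist y k ≤ (10011 / 10000 : ℝ) ^ d * nearestDist y j₀ ∧
        Estab y A P B i k M C (tadd lam₀ x) (τs d) (Ds d) := by
  intro d
  induction d with
  | zero =>
    intro _ x _ hl
    have hx0 : x = (0, 0, 0) := eq_zero_of_lnorm_le x (by simpa using hl)
    subst hx0
    refine ⟨j₀, M₀, hj₀, by simp, by simp, ?_⟩
    rw [tadd_zero_right]
    exact hE₀
  | succ d ih =>
    intro hdn x hx hl
    have hdn' : d ≤ n := (Nat.le_succ d).trans hdn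
    have hΛ1 : (1 : ℝ) ≤ 10011 / 10000 := by norm_num
    have hnn₀ : 0 ≤ nearestDist y j₀ := nearestDist_nonneg y j₀
    by_cases hl' : lnorm x ≤ 6 * (d : ℤ)
    · obtain ⟨k, M, hkr, hlo, hhi, hE⟩ := ih hdn' x hx hl'
      refine ⟨k, M, hkr, ?_, ?_, estab_mono hE (hτmono (Nat.le_succ d)) (hDmono (Nat.le_succ d))⟩
      · have h1 : (9967 / 10000 : ℝ) ^ (d + 1) * nearestDist y j₀ ≤ (9967 / 10000 : ℝ) ^ d * nearestDist y j₀ :=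
          mul_le_mul_of_nonneg_right (pow_le_pow_of_le_one (by norm_num) (by norm_num) (Nat.le_succ d)) hnn₀
        exact h1.trans hlo
      · have h1 : (10011 / 10000 : ℝ) ^ d * nearestDist y j₀ ≤ (10011 / 10000 : ℝ) ^ (d + 1) * nearestDist y j₀ :=
          mul_le_mul_of_nonneg_right (pow_le_pow_right₀ hΛ1 (Nat.le_succ d)) hnn₀
        exact hhi.trans h1
    · have hne : x ≠ (0, 0, 0) := by
        rintro rfl
        apply hl'
        simp only [lnorm, abs_zero, add_zero]
        positivity
      obtain ⟨h, hh, hdesc⟩ := hex_descent hx hne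
      have hfacts := hexL_facts h hh
      have hx'L : InLayer (tsub x h) := inLayer_tsub hx hfacts.1
      have hcast : ((d + 1 : ℕ) : ℤ) = (d : ℤ) + 1 := by push_cast; ring
      have hl'' : lnorm (tsub x h) ≤ 6 * (d : ℤ) := by rw [hcast] at hl; linarith
      obtain ⟨p, Mp, hpr, hplo, hphi, hEp⟩ := ih hdn' (tsub x h) hx'L hl''
      have hdnZ : ((d + 1 : ℕ) : ℤ) ≤ (n : ℤ) := by exact_mod_cast hdn
      have hroomx := hroom x hx (hl.trans (by linarith))
      have hDn : Ds (d + 1) ≤ Ds n := hDmono hdn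
      have h2p : 1 / 10 ^ 4 * nearestDist y p ≤ 1 / 10 ^ 4 * ((10011 / 10000 : ℝ) ^ d * nearestDist y j₀) :=
        mul_le_mul_of_nonneg_left hphi (by norm_num)
      have hDstep := hDs d hdn
      have hball : ‖B (mv (tadd (tadd lam₀ (tsub x h)) h))‖ + (Ds d + 1 / 10 ^ 4 * nearestDist y p + τs d) ≤ r := by
        rw [tadd_tadd_tsub]
        linarith
      obtain ⟨k, v, -, -, -, -, hkr, hsc, hsc', R₁, -, Q, hQ, hEk⟩ :=
        estab_child_one hy hP hA hf hinj hex hpr hEp (hhexC h hh) hfacts.2 (hhexxs h hh) hKf hKh hlf hlh hball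
      have hQC' : Q = C := hQC k hkr Q hQ
      rw [hQC', tadd_tadd_tsub] at hEk
      have hkhi : nearestDist y k ≤ (10011 / 10000 : ℝ) ^ (d + 1) * nearestDist y j₀ := by
        have h1 : 10011 / 10000 * nearestDist y p ≤ 10011 / 10000 * ((10011 / 10000 : ℝ) ^ d * nearestDist y j₀) :=
          mul_le_mul_of_nonneg_left hphi (by norm_num)
        have e : 10011 / 10000 * ((10011 / 10000 : ℝ) ^ d * nearestDist y j₀) = (10011 / 10000 : ℝ) ^ (d + 1) * nearestDist y j₀ := by
          rw [pow_succ]; ring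
        linarith
      have hklo : (9967 / 10000 : ℝ) ^ (d + 1) * nearestDist y j₀ ≤ nearestDist y k := by
        have h1 : 9967 / 10000 * ((9967 / 10000 : ℝ) ^ d * nearestDist y j₀) ≤ 9967 / 10000 * nearestDist y p :=
          mul_le_mul_of_nonneg_left hplo (by norm_num)
        have e : 9967 / 10000 * ((9967 / 10000 : ℝ) ^ d * nearestDist y j₀) = (9967 / 10000 : ℝ) ^ (d + 1) * nearestDist y j₀ := by
          rw [pow_succ]; ring
        linarith
      refine ⟨k, Mp.comp R₁, hkr, hklo, hkhi, estab_mono hEk ?_ ?_⟩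
      · have h1 := hτs d hdn
        have h2 : 2 * (1 / 10 ^ 4) * nearestDist y p ≤ 2 * (1 / 10 ^ 4) * ((10011 / 10000 : ℝ) ^ d * nearestDist y j₀) :=
          mul_le_mul_of_nonneg_left hphi (by norm_num)
        have h3 : 1 / 10 ^ 4 * nearestDist y k ≤ 1 / 10 ^ 4 * ((10011 / 10000 : ℝ) ^ (d + 1) * nearestDist y j₀) :=
          mul_le_mul_of_nonneg_left hkhi (by norm_num)
        linarith
      · linarith

/-- `hexL ⊆ H`, `hexL ⊆ H′`, `hexL ⊆ F⁺`, `hexL ⊆ F⁻`, `hexL ⊆ fccShellL` (by `decide`). [this file] -/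
theorem hexL_sub : (∀ h ∈ hexL, h ∈ hcpL) ∧ (∀ h ∈ hexL, h ∈ hcpAltL) ∧ (∀ h ∈ hexL, h ∈ fccL) ∧ (∀ h ∈ hexL, h ∈ fccNegL) ∧
    (∀ h ∈ hexL, h ∈ fccShellL) := by
  decide

/-- The two patterns are different finite sets (`mv (0,0,−6) ∈ F⁺`-listed fcc pattern, not in the `H`-listed hcp pattern). [this file] -/
theorem fcc_ne_hcp : fccTwoShellPattern ≠ hcpTwoShellPattern := by
  intro h
  have h1 : mv (0, 0, -6) ∈ fccTwoShellPattern := listedBy_fcc.2 _ (by decide)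
  rw [h] at h1
  obtain ⟨W, hW, hW'⟩ := listedBy_hcp.1 _ h1
  have hW0 : W = (0, 0, -6) := (mv_injective hW'.symm)
  rw [hW0] at hW
  exact absurd hW (by decide)

/-- **Record instance (Step S, base site hcp).**  Base `i` hcp, identity chart onto `H`, base frame `nn_i·A_i`, tables E1 — with NO hypothesis on the types
of the other sites: every point of the basal layer disc of hex radius `n` (room permitting) is the label of an established `H`-charted site. [this file] -/
theorem layer_disc_hcp_base {y : Fin N → EuclideanSpace ℝ (Fin 3)} (hy : Function.Injective y) {r : ℝ} {i : Fin N}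
    {A : Fin N → (EuclideanSpace ℝ (Fin 3) →ₗ[ℝ] EuclideanSpace ℝ (Fin 3))} {Qf : Fin N → (EuclideanSpace ℝ (Fin 3) →ₗᵢ[ℝ] EuclideanSpace ℝ (Fin 3))}
    {P : Fin N → Finset (EuclideanSpace ℝ (Fin 3))} {f : Fin N → EuclideanSpace ℝ (Fin 3) → EuclideanSpace ℝ (Fin 3)}
    (hP : ∀ j, dist (y j) (y i) ≤ r → (P j = fccTwoShellPattern ∨ P j = hcpTwoShellPattern))
    (hA : ∀ j, dist (y j) (y i) ≤ r → ∀ v ∈ P j, ‖A j v - Qf j v‖ ≤ 1 / 1000)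
    (hf : ∀ j, dist (y j) (y i) ≤ r → ∀ v ∈ P j, f j v ∈ Set.range y ∧ dist (f j v) (y j + nearestDist y j • A j v) ≤ 1 / 10 ^ 4 * nearestDist y j)
    (hinj : ∀ j, dist (y j) (y i) ≤ r → Set.InjOn (f j) ↑(P j))
    (hex : ∀ j, dist (y j) (y i) ≤ r → ∀ m, m ≠ j → dist (y m) (y j) ≤ (3 / 2 + 1 / 450) * nearestDist y j → ∃ v ∈ P j, f j v = y m)
    (hr : 0 ≤ r) (hPi : P i = hcpTwoShellPattern) {τs Ds : ℕ → ℝ} {n : ℕ} (hτ0 : 0 ≤ τs 0) (hD0 : 0 ≤ Ds 0)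
    (hτmono : Monotone τs) (hDmono : Monotone Ds)
    (hτs : ∀ d : ℕ, d + 1 ≤ n → τs d + 5 / 2 * (2 * (1 / 10 ^ 4) * ((10011 / 10000 : ℝ) ^ d * nearestDist y i) +
      1 / 10 ^ 4 * ((10011 / 10000 : ℝ) ^ (d + 1) * nearestDist y i)) ≤ τs (d + 1))
    (hDs : ∀ d : ℕ, d + 1 ≤ n → Ds d + 1 / 10 ^ 4 * ((10011 / 10000 : ℝ) ^ d * nearestDist y i) + τs d ≤ Ds (d + 1))
    (hroom : ∀ x, InLayer x → lnorm x ≤ 6 * (n : ℤ) → ‖(nearestDist y i • A i) (mv x)‖ + Ds n ≤ r)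
    {x : T3} (hx : InLayer x) (hl : lnorm x ≤ 6 * (n : ℤ)) :
    ∃ k : Fin N, ∃ M : EuclideanSpace ℝ (Fin 3) →ₗᵢ[ℝ] EuclideanSpace ℝ (Fin 3), dist (y k) (y i) ≤ r ∧
      (9967 / 10000 : ℝ) ^ n * nearestDist y i ≤ nearestDist y k ∧ nearestDist y k ≤ (10011 / 10000 : ℝ) ^ n * nearestDist y i ∧
      Estab y A P (nearestDist y i • A i) i k M hcpL x (τs n) (Ds n) := by
  have hE₀ : Estab y A P (nearestDist y i • A i) i i LinearIsometry.id hcpL (0, 0, 0) (τs 0) (Ds 0) :=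
    estab_mono (estab_seed (by rw [hPi]; exact listedBy_hcp)) hτ0 hD0
  have hi : dist (y i) (y i) ≤ r := by rw [dist_self]; exact hr
  have hQC : ∀ k, dist (y k) (y i) ≤ r → ∀ Q : List T3,
      ((P k = fccTwoShellPattern ∧ Q ∈ ([] : List (List T3))) ∨ (P k = hcpTwoShellPattern ∧ Q ∈ [hcpL])) → Q = hcpL := by
    intro k _ Q hQ
    rcases hQ with ⟨-, hQ⟩ | ⟨-, hQ⟩
    · simp at hQ
    · simpa using hQ
  have hroom' : ∀ x, InLayer x → lnorm x ≤ 6 * (n : ℤ) → ‖(nearestDist y i • A i) (mv (tadd (0, 0, 0) x))‖ + Ds n ≤ r := by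
    intro x hx hl
    rw [tadd_zero_left]
    exact hroom x hx hl
  have h := layer_disc hy hP hA hf hinj hex e1_entries.1 e1_entries.2.1 (by simp) (by decide) hexL_sub.1 (fun h hh => hh) hQC hi hE₀
    hτmono hDmono hτs hDs hroom' n le_rfl x hx hl
  rw [tadd_zero_left] at h
  exact h

/-- **Record instance (Step S, all-fcc ball).**  Base `i` in a ball all of whose sites are fcc, identity chart onto `F⁺`, tables KF: every point of the
`(1,1,1)`-layer disc of hex radius `n` through `i` (room permitting) is the label of an established `F⁺`-charted site. [this file] -/
theorem layer_disc_fcc_ball {y : Fin N → EuclideanSpace ℝ (Fin 3)} (hy : Function.Injective y) {r : ℝ} {i : Fin N}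
    {A : Fin N → (EuclideanSpace ℝ (Fin 3) →ₗ[ℝ] EuclideanSpace ℝ (Fin 3))} {Qf : Fin N → (EuclideanSpace ℝ (Fin 3) →ₗᵢ[ℝ] EuclideanSpace ℝ (Fin 3))}
    {P : Fin N → Finset (EuclideanSpace ℝ (Fin 3))} {f : Fin N → EuclideanSpace ℝ (Fin 3) → EuclideanSpace ℝ (Fin 3)}
    (hfcc : ∀ j, dist (y j) (y i) ≤ r → P j = fccTwoShellPattern)
    (hA : ∀ j, dist (y j) (y i) ≤ r → ∀ v ∈ P j, ‖A j v - Qf j v‖ ≤ 1 / 1000)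
    (hf : ∀ j, dist (y j) (y i) ≤ r → ∀ v ∈ P j, f j v ∈ Set.range y ∧ dist (f j v) (y j + nearestDist y j • A j v) ≤ 1 / 10 ^ 4 * nearestDist y j)
    (hinj : ∀ j, dist (y j) (y i) ≤ r → Set.InjOn (f j) ↑(P j))
    (hex : ∀ j, dist (y j) (y i) ≤ r → ∀ m, m ≠ j → dist (y m) (y j) ≤ (3 / 2 + 1 / 450) * nearestDist y j → ∃ v ∈ P j, f j v = y m)
    (hr : 0 ≤ r) {τs Ds : ℕ → ℝ} {n : ℕ} (hτ0 : 0 ≤ τs 0) (hD0 : 0 ≤ Ds 0) (hτmono : Monotone τs) (hDmono : Monotone Ds)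
    (hτs : ∀ d : ℕ, d + 1 ≤ n → τs d + 5 / 2 * (2 * (1 / 10 ^ 4) * ((10011 / 10000 : ℝ) ^ d * nearestDist y i) +
      1 / 10 ^ 4 * ((10011 / 10000 : ℝ) ^ (d + 1) * nearestDist y i)) ≤ τs (d + 1))
    (hDs : ∀ d : ℕ, d + 1 ≤ n → Ds d + 1 / 10 ^ 4 * ((10011 / 10000 : ℝ) ^ d * nearestDist y i) + τs d ≤ Ds (d + 1))
    (hroom : ∀ x, InLayer x → lnorm x ≤ 6 * (n : ℤ) → ‖(nearestDist y i • A i) (mv x)‖ + Ds n ≤ r)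
    {x : T3} (hx : InLayer x) (hl : lnorm x ≤ 6 * (n : ℤ)) :
    ∃ k : Fin N, ∃ M : EuclideanSpace ℝ (Fin 3) →ₗᵢ[ℝ] EuclideanSpace ℝ (Fin 3), dist (y k) (y i) ≤ r ∧
      (9967 / 10000 : ℝ) ^ n * nearestDist y i ≤ nearestDist y k ∧ nearestDist y k ≤ (10011 / 10000 : ℝ) ^ n * nearestDist y i ∧
      Estab y A P (nearestDist y i • A i) i k M fccL x (τs n) (Ds n) := by
  have hP : ∀ j, dist (y j) (y i) ≤ r → (P j = fccTwoShellPattern ∨ P j = hcpTwoShellPattern) := fun j hj => Or.inl (hfcc j hj)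
  have hi : dist (y i) (y i) ≤ r := by rw [dist_self]; exact hr
  have hE₀ : Estab y A P (nearestDist y i • A i) i i LinearIsometry.id fccL (0, 0, 0) (τs 0) (Ds 0) :=
    estab_mono (estab_seed (by rw [hfcc i hi]; exact listedBy_fcc)) hτ0 hD0
  have hQC : ∀ k, dist (y k) (y i) ≤ r → ∀ Q : List T3,
      ((P k = fccTwoShellPattern ∧ Q ∈ [fccL]) ∨ (P k = hcpTwoShellPattern ∧ Q ∈ hcpFamilyL)) → Q = fccL := by
    intro k hk Q hQ
    rcases hQ with ⟨-, hQ⟩ | ⟨hPk, -⟩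
    · simpa using hQ
    · exact absurd (hPk.symm.trans (hfcc k hk)).symm fcc_ne_hcp
  have hroom' : ∀ x, InLayer x → lnorm x ≤ 6 * (n : ℤ) → ‖(nearestDist y i • A i) (mv (tadd (0, 0, 0) x))‖ + Ds n ≤ r := by
    intro x hx hl
    rw [tadd_zero_left]
    exact hroom x hx hl
  have h := layer_disc hy hP hA hf hinj hex kf_fcc kf_hcp (by decide) (by decide) hexL_sub.2.2.1 hexL_sub.2.2.2.2 hQC hi hE₀
    hτmono hDmono hτs hDs hroom' n le_rfl x hx hl
  rw [tadd_zero_left] at h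
  exact h

end Summit.AtomisticToContinuum.Crystallization.Theorems.OverbindingBudgetAffineCompressedCutSeed
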